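import Summits.CriticalPhenomena.SAWScalingLimit.Theorems.SAWDevelopingMapHexTransferThirdBdryEndpoints
import Summits.CriticalPhenomena.SAWScalingLimit.Theorems.SAWDevelopingMapHexTransferYbRelayDefs
import Literature.Probability.RandomPlanarGeometry.SAWScalingLimitFamily
import HarnessLib

/-!
# `ShiftedBdryEndpoints` (line `registered` = `birth` v3.3, crux `LatticeUniversality`,
# stmt-CriticalPhenomena-0807)

Stub `stub_shiftedBdryEndpoints` of the line `registered` for the crux
`Summit.CriticalPhenomena.SAWScalingLimit.Theses.SAWMassiveIsingTilt.LatticeUniversality`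
(stmt-CriticalPhenomena-0807; the Yang–Baxter relay for lattice universality of the critical
chordal SAW law): **boundary mid-edge endpoint approximations for `O(δ)`-MOVING domains.** For
every Dobrushin domain `D = (Ω; a, b)` and every family of translates `u δ` with `‖u δ‖ ≤ δ`
eventually along `δ → 0⁺`, there are mid-edges `a'_δ, b'_δ` of Glazman–Manolescu's hexagonal
point `Θ ≡ π/3` which, for all small `δ > 0`, are distinct BOUNDARY edges of the face set
`(Ω + u δ)_δ = meshFaces (π/3) (Ω + u δ) δ` of the translated domain (exactly one of the two
faces of each lies in it), are joined by a Yang–Baxter walk of `(Ω + u δ)_δ`, and satisfy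
`δ a'_δ → a`, `δ b'_δ → b`. The skeleton instantiates `D := σD`, `u δ := -iδ/2` (the half-period
shift of the `π/3` honeycomb).

Proof: the fixed-domain construction of
`Cruxes.HexTransfer.YbRelay.ThirdEndpoints.exists_bdry_threshold` / `ybBdryEndpoints`
(`Theorems/SAWDevelopingMapHexTransferThirdBdryEndpoints`), run in the translated domain
`Ω + t`, `t = u δ`: the bulk set `V` (with `ρ`-discs inside `Ω`, `ρ ≥ 5δ`) of the FIXED domain
about interior points `z, w` is translated to `V + t` (discs inside `Ω + t`); the faces of
`(z + t)/δ`, `(w + t)/δ` lie in `(Ω + t)_δ` and are joined there (bulk lemma); the skew-`ℓ¹`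
closest faces of their component to the outside points `a + t`, `b + t` have a side bordering no
other face (`exists_bdrySide_near`), within `4 |z - a| + 4δ` of `a + t`, hence within
`4 |z - a| + 5δ` of `a` as `‖t‖ ≤ δ`; the two sides are joined by a Yang–Baxter walk
(`nonempty_ybWalk_of_reachable`). Then interior points `z_n → a`, `w_n → b`, diagonal stage
selection (`exists_stage_tendsto_atTop`), and eventual distinctness of `a'_δ, b'_δ` from
`δ a'_δ → a ≠ b ← δ b'_δ`.
-/

noncomputable section

namespace Summit.CriticalPhenomena.SAWScalingLimit.Cruxes.LatticeUniversality.Birth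

open MeasureTheory Filter Topology Set Metric
open Complex (I I_ne_zero)
open Literature.Probability.RandomPlanarGeometry
open Literature.Probability.RandomPlanarGeometry.SAW.YangBaxter
open Summit.CriticalPhenomena.SAWScalingLimit.Cruxes.HexTransfer.YbRelay (third IsBdryEdge
  nonempty_ybWalk_of_reachable)
open Summit.CriticalPhenomena.SAWScalingLimit.Cruxes.HexTransfer.YbRelay.ThirdEndpoints

namespace ShiftedEndpoints

/-- **Stage threshold in translated domains.** Let `z, w ∈ Ω` (a Dobrushin domain) and
`p, q ∉ Ω`. There is `ε > 0` such that for every mesh `0 < δ < ε` and every translate `t`,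
`‖t‖ ≤ δ`, there are boundary edges `a, b` of `(Ω + t)_δ = meshFaces (π/3) (Ω + t) δ`, joined by
a Yang–Baxter walk of `(Ω + t)_δ`, with `|δ a - p| ≤ 4 |z - p| + 5δ`, `|δ b - q| ≤ 4 |w - q| + 5δ`
(the bulk set of `Ω` about `z, w` translated by `t`; `exists_bdrySide_near` at the outside points
`p + t`, `q + t`; `nonempty_ybWalk_of_reachable`). Stated as `∀ δ t, ∃ a b, 0 < δ → δ < ε →
‖t‖ ≤ δ → …`. [folklore] -/
theorem exists_bdry_threshold_translate (D : DobrushinDomain) {z w : ℂ} (hz : z ∈ D.carrier)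
    (hw : w ∈ D.carrier) {p q : ℂ} (hp : p ∉ D.carrier) (hq : q ∉ D.carrier) :
    ∃ ε : ℝ, 0 < ε ∧ ∀ (δ : ℝ) (t : ℂ), ∃ a b : MidEdge, 0 < δ → δ < ε → ‖t‖ ≤ δ →
      IsBdryEdge (meshFaces third ((D.map (similarity 1 one_ne_zero t)).carrier) δ) a ∧
      IsBdryEdge (meshFaces third ((D.map (similarity 1 one_ne_zero t)).carrier) δ) b ∧
      Nonempty (YangBaxterSAW third ((D.map (similarity 1 one_ne_zero t)).carrier) δ a b) ∧
      dist ((δ : ℂ) * planeMidpoint third a) p ≤ 4 * dist z p + 5 * δ ∧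
      dist ((δ : ℂ) * planeMidpoint third b) q ≤ 4 * dist w q + 5 * δ := by
  have hθ : Real.pi / 3 ∈ Icc (Real.pi / 3) (2 * Real.pi / 3) := ⟨le_rfl, by linarith [Real.pi_pos]⟩
  have hs := half_lt_sin hθ
  have hc := abs_cos_le_half hθ
  have hs0 : Real.sin (Real.pi / 3) ≠ 0 := by positivity
  have hK : ({z, w} : Set ℂ) ⊆ D.carrier := by
    intro x hx
    simp only [Set.mem_insert_iff, Set.mem_singleton_iff] at hx
    rcases hx with rfl | rfl
    exacts [hz, hw]
  obtain ⟨V, -, hVc, hKV, -, ρ, hρ, hVρ⟩ :=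
    Literature.Probability.LatticeModels.exists_isOpen_isPreconnected_bulk D.isOpen D.isConnected
      (Set.nonempty_compl.2 D.toJordanDomain.carrier_ne_univ) (Set.toFinite {z, w}).isCompact hK
  have hVΩ : ∀ x ∈ V, ball x ρ ⊆ D.carrier := fun x hx =>
    (ball_subset_ball (hVρ x hx).le).trans ball_infDist_compl_subset
  have hzV : z ∈ V := hKV (by simp)
  have hwV : w ∈ V := hKV (by simp)
  refine ⟨ρ / 5, by positivity, fun δ t => ?_⟩
  by_cases hgood : 0 < δ ∧ δ < ρ / 5 ∧ ‖t‖ ≤ δ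
  swap
  · exact ⟨.vert 0 0, .vert 0 0, fun h₁ h₂ h₃ => absurd ⟨h₁, h₂, h₃⟩ hgood⟩
  obtain ⟨hδ, hδε, ht⟩ := hgood
  have hδρ : 5 * δ ≤ ρ := by linarith
  -- the translated domain `Ω + t`
  have hmem : ∀ y : ℂ, y ∈ (D.map (similarity 1 one_ne_zero t)).carrier ↔ y - t ∈ D.carrier := by
    intro y
    simp only [MarkedDomain.carrier_map, Set.mem_image, similarity_apply, one_mul]
    constructor
    · rintro ⟨x, hx, rfl⟩
      rwa [add_sub_cancel_right]
    · exact fun h => ⟨y - t, h, sub_add_cancel y t⟩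
  have hpt : p + t ∉ (D.map (similarity 1 one_ne_zero t)).carrier := fun h =>
    hp (by rwa [hmem, add_sub_cancel_right] at h)
  have hqt : q + t ∉ (D.map (similarity 1 one_ne_zero t)).carrier := fun h =>
    hq (by rwa [hmem, add_sub_cancel_right] at h)
  -- the translated bulk set `V + t`
  have hVc' : IsPreconnected ((fun x : ℂ => x + t) '' V) :=
    hVc.image _ (continuous_add_const t).continuousOn
  have hVΩ' : ∀ x ∈ (fun x : ℂ => x + t) '' V,
      ball x ρ ⊆ (D.map (similarity 1 one_ne_zero t)).carrier := by
    rintro _ ⟨y, hy, rfl⟩ v hv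
    rw [hmem]
    apply hVΩ y hy
    rw [mem_ball, dist_eq_norm] at hv ⊢
    rwa [show v - t - y = v - (y + t) by ring]
  have hzV' : z + t ∈ (fun x : ℂ => x + t) '' V := ⟨z, hzV, rfl⟩
  have hwV' : w + t ∈ (fun x : ℂ => x + t) '' V := ⟨w, hwV, rfl⟩
  have hfin := meshFaces_const_finite hs hc (D.map (similarity 1 one_ne_zero t)).isBounded hδ
  have hfz := mem_meshFaces_const_of_dist_lt hδ hδρ (hVΩ' (z + t) hzV')
    ((dist_planeCorner_face_lt hs0 ((z + t) / δ)).trans (by norm_num))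
  have hfw := mem_meshFaces_const_of_dist_lt hδ hδρ (hVΩ' (w + t) hwV')
    ((dist_planeCorner_face_lt hs0 ((w + t) / δ)).trans (by norm_num))
  have hreach := reachable_const_of_mem hs hc hVc' hVΩ' hδ hδρ hzV' hwV'
  obtain ⟨ga, ea, hgaS, hga, hea, hua, hda⟩ :=
    exists_bdrySide_near hs hc hδ hfin hpt (SimpleGraph.Reachable.refl _) hfz
  obtain ⟨gb, eb, hgbS, hgb, heb, hub, hdb⟩ := exists_bdrySide_near hs hc hδ hfin hqt hreach hfw
  rw [dist_add_right] at hda hdb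
  have hpt' : dist (p + t) p ≤ δ := by rwa [dist_eq_norm, add_sub_cancel_left]
  have hqt' : dist (q + t) q ≤ δ := by rwa [dist_eq_norm, add_sub_cancel_left]
  refine ⟨ea, eb, fun _ _ _ => ⟨isBdry_of_unique hea hgaS hua, isBdry_of_unique heb hgbS hub,
    nonempty_ybWalk_of_reachable _ ga gb (hga.symm.trans hgb) hgaS ea eb hea hua heb hub, ?_, ?_⟩⟩
  · calc dist ((δ : ℂ) * planeMidpoint third ea) p
          ≤ dist ((δ : ℂ) * planeMidpoint third ea) (p + t) + dist (p + t) p := dist_triangle _ _ _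
      _ ≤ 4 * dist z p + 4 * δ + δ := add_le_add hda hpt'
      _ = 4 * dist z p + 5 * δ := by ring
  · calc dist ((δ : ℂ) * planeMidpoint third eb) q
          ≤ dist ((δ : ℂ) * planeMidpoint third eb) (q + t) + dist (q + t) q := dist_triangle _ _ _
      _ ≤ 4 * dist w q + 4 * δ + δ := add_le_add hdb hqt'
      _ = 4 * dist w q + 5 * δ := by ring

/-- If, eventually along `δ → 0⁺`, `u δ` is within `4 |z (N δ) - p| + 5δ` of `p`, `z n → p` at
rate `1/(n+1)` and `N δ → ∞`, then `u δ → p` (the `5δ` variant of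
`ThirdEndpoints.tendsto_of_eventually_dist_le`). [folklore] -/
theorem tendsto_of_eventually_dist_le_five {u : ℝ → ℂ} {z : ℕ → ℂ} {p : ℂ} {N : ℝ → ℕ}
    (hu : ∀ᶠ δ in 𝓝[>] (0 : ℝ), dist (u δ) p ≤ 4 * dist (z (N δ)) p + 5 * δ)
    (hz : ∀ n, dist (z n) p < 1 / ((n : ℝ) + 1)) (hN : Tendsto N (𝓝[>] (0 : ℝ)) atTop) :
    Tendsto u (𝓝[>] (0 : ℝ)) (𝓝 p) := by
  rw [Metric.tendsto_nhds]
  intro ε hε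
  obtain ⟨n₀, hn₀⟩ := exists_nat_one_div_lt (show 0 < ε / 10 by positivity)
  filter_upwards [hu, Ioo_mem_nhdsGT (show (0 : ℝ) < ε / 10 by positivity),
    hN.eventually (eventually_ge_atTop n₀)] with δ huδ hδ hNδ
  have h2 : dist (z (N δ)) p < ε / 10 := by
    refine (hz (N δ)).trans_le ((one_div_le_one_div_of_le (by positivity) ?_).trans hn₀.le)
    have : (n₀ : ℝ) ≤ N δ := by exact_mod_cast hNδ
    linarith
  linarith [hδ.2]

end ShiftedEndpoints

open ShiftedEndpoints in
/-- **Stub `stub_shiftedBdryEndpoints`** (line `registered` v3.3, crux `LatticeUniversality`,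
stmt-CriticalPhenomena-0807; `ShiftedBdryEndpoints` unfolded): for every Dobrushin domain
`D = (Ω; a, b)` and every family of translates `u δ`, `‖u δ‖ ≤ δ` eventually, there are mid-edges
`a'_δ ≠ b'_δ` which, for all small `δ > 0`, are boundary edges of `meshFaces (π/3) (Ω + u δ) δ`
joined by a Yang–Baxter walk of that face set, with `δ a'_δ → a`, `δ b'_δ → b`. Interior points
`z_n → a`, `w_n → b`; translated stage thresholds `exists_bdry_threshold_translate` (with the
outside points `a, b ∈ ∂Ω`, `Ω` open); diagonal stage selection `exists_stage_tendsto_atTop`;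
distinctness from `a ≠ b` (Hausdorff separation). [folklore] -/
theorem stub_shiftedBdryEndpoints : ∀ (D : DobrushinDomain) (u : ℝ → ℂ), (∀ᶠ δ in 𝓝[>] (0 : ℝ), ‖u δ‖ ≤ δ) → ∃ a' b' : ℝ → MidEdge, (∀ᶠ δ in 𝓝[>] (0 : ℝ), a' δ ≠ b' δ ∧ IsBdryEdge (meshFaces third ((D.map (similarity 1 one_ne_zero (u δ))).carrier) δ) (a' δ) ∧ IsBdryEdge (meshFaces third ((D.map (similarity 1 one_ne_zero (u δ))).carrier) δ) (b' δ) ∧ Nonempty (YangBaxterSAW third ((D.map (similarity 1 one_ne_zero (u δ))).carrier) δ (a' δ) (b' δ))) ∧ Tendsto (fun δ : ℝ => (δ : ℂ) * planeMidpoint third (a' δ)) (𝓝[>] (0 : ℝ)) (𝓝 (D.pt 0)) ∧ Tendsto (fun δ : ℝ => (δ : ℂ) * planeMidpoint third (b' δ)) (𝓝[>] (0 : ℝ)) (𝓝 (D.pt 1)) := by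
  classical
  intro D u hu
  -- interior points `z i n → D.pt i`
  have hz : ∀ (i : Fin 2) (n : ℕ), ∃ z ∈ D.carrier, dist z (D.pt i) < 1 / ((n : ℝ) + 1) := by
    intro i n
    obtain ⟨z, hz, hd⟩ := Metric.mem_closure_iff.1
      (frontier_subset_closure (D.pt_mem_frontier i)) (1 / ((n : ℝ) + 1)) (by positivity)
    exact ⟨z, hz, by rwa [dist_comm]⟩
  choose z hzΩ hzd using hz
  have hpt : ∀ i : Fin 2, D.pt i ∉ D.carrier := fun i h => by
    have hf := D.pt_mem_frontier i
    rw [frontier, D.isOpen.interior_eq] at hf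
    exact hf.2 h
  have hst := fun n => exists_bdry_threshold_translate D (hzΩ 0 n) (hzΩ 1 n) (hpt 0) (hpt 1)
  choose ε hε hgood using hst
  choose a b hab using hgood
  obtain ⟨N, hN, hNtop⟩ := exists_stage_tendsto_atTop (p := fun n δ => 0 < δ ∧ δ < ε n)
    (ε := ε) hε (fun n δ h₁ h₂ => ⟨h₁, h₂⟩)
  have hgoodN := (hN.and hu).mono fun δ h => hab (N δ) δ (u δ) h.1.1 h.1.2 h.2
  have hta : Tendsto (fun δ : ℝ => (δ : ℂ) * planeMidpoint third (a (N δ) δ (u δ))) (𝓝[>] (0 : ℝ))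
      (𝓝 (D.pt 0)) :=
    tendsto_of_eventually_dist_le_five (hgoodN.mono fun δ h => h.2.2.2.1) (hzd 0) hNtop
  have htb : Tendsto (fun δ : ℝ => (δ : ℂ) * planeMidpoint third (b (N δ) δ (u δ))) (𝓝[>] (0 : ℝ))
      (𝓝 (D.pt 1)) :=
    tendsto_of_eventually_dist_le_five (hgoodN.mono fun δ h => h.2.2.2.2) (hzd 1) hNtop
  -- the two approximations are eventually distinct, as `D.pt 0 ≠ D.pt 1`
  have hne : ∀ᶠ δ in 𝓝[>] (0 : ℝ), a (N δ) δ (u δ) ≠ b (N δ) δ (u δ) := by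
    have h01 : D.pt 0 ≠ D.pt 1 := fun h => absurd (D.pt_injective h) (by decide)
    obtain ⟨U, W, hU, hW, hpU, hpW, hUW⟩ := t2_separation h01
    filter_upwards [hta.eventually_mem (hU.mem_nhds hpU), htb.eventually_mem (hW.mem_nhds hpW)]
      with δ ha hb hab'
    rw [hab'] at ha
    exact Set.disjoint_left.1 hUW ha hb
  refine ⟨fun δ => a (N δ) δ (u δ), fun δ => b (N δ) δ (u δ), ?_, hta, htb⟩
  filter_upwards [hne, hgoodN] with δ h₁ h₂
  exact ⟨h₁, h₂.1, h₂.2.1, h₂.2.2.1⟩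

end Summit.CriticalPhenomena.SAWScalingLimit.Cruxes.LatticeUniversality.Birth

end
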